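import Summits.Ventures.HSemireg.Pad4TowerLemmaA2I
import Summits.Ventures.HSemireg.Pad4TowerPsi

/-!
# Venture HSemireg — PAD-4: the tower universe U(D_T1) is CLOSED AT FIRST ORDER — (F1ℝ) slice, assembled in the kernel
# from the tower files (Ψ∕μ squeeze onto the three tower species; their LEMMA-A∪2I′ clean-form death in G-invariant supports)

HONEST FRAMING. Lean index of the computation cell `pub-hsemireg` (S4-PUSH, H2 door PAD-4); seat `hodge-semireg-assembly-p1`
(director-hodge g7 WIDTH-LEVER W2 on stmt-HodgeConjecture-18881, ladder REQUESTS l.12454: «assembly from typed lemmas — prove the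
negative universe-closure statements as Lean theorems from the four refereed tower files»). This file ASSEMBLES census entry 3 of
the cell's ladder desk, **U(D_T1-universe) c94531e97af3470b** (director-hodge g7 2026-08-27T09:16:28Z, FINAL 10:11:10Z; kills ×2
s4-ref-2 g10 3f87db5a1884753a + s4-ref g71 30a58cd959697c55, squeeze gs-eng-2 g48 l.30214 ×2 s4-ref-2 g11), as ONE KERNEL
THEOREM `dt1_universe_closed` over the vocabulary of `Pad4TowerLemmaT` ∕ `Pad4TowerLemmaA2I` (cells, configurations, `A2IDead`)
and `Pad4TowerPsi` (`psiLC`, `dt1Orbits`): «UNIVERSE = the 46-orbit universe generated by D_T1 = T376^G. Every (H1)-alive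
G-closed support inside this universe carries negative-Ψ mass on one of the three tower N-orbits o35 [O|ℓ|ℓ|2I+ℓ], o38
[O|ℓ|2ℓ|2I+ℓ], o41 [O|2ℓ|2ℓ|2I+ℓ], and all three orbits are DEAD support-independently by LEMMA A∪2I′ in its clean sufficient
form (W = ∅, Dir = {u}; partner = the single RULE-D-forced P-orbit, servers in the own orbit, census empty).»

SCOPE — THE (F1ℝ) SLICE. The census universe is a μ₄ object (phases `ζ ∈ μ₄` on every charged factor); the kill predicates the
tree HAS (`StaticDeadW0∕W1`, `A2IDead`) are typed on the (F1ℝ) light-cone alphabet `Cell := Fin 4 → Fin 2 → ℕ` of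
`Pad4TowerLemmaT` — two null directions per factor, i.e. the phases `±1`. This file therefore states and proves the census entry
ON THAT SLICE: cells whose phase-blind shape (`Cell.key`, the multiset of normalised letters `(max, min)` of the four factors) is
one of the 30 `N`-shapes ∕ 16 `P`-shapes of `dt1Orbits`, either side on each factor, any placement — exactly the `ζ ∈ {±1}`
members of the 46 orbits; of «G-invariant» only the `S₄` relabelling part is used (`GInvariant`). The μ₄ universe proper needs
the μ₄ form of the clean-form kill predicate (four null directions on the state factor), which no tree file has (the fifth tower
file `Pad4TowerCrossPhase` types μ₄ cells `MCell` for LEMMA X-PHASE only): NOT claimed here. The pencil argument is phase-blind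
((F-a)–(F-d) of the two verdicts), so the μ₄ lift is a typing task, not a new proof — flagged, not done.

CONTENT. §1 keys (`nl`, `Cell.key`, O-count lemmas). §2 the universe by keys (`dt1NKeys`, `dt1PKeys` computed from
`Pad4TowerPsi.dt1Orbits`; `speciesKeys`; `InDT1N`, `InDT1P`) and the ONE support fact the kill reads, `decide`d:
`dt1P_tower_two_O` («no P-shape carries the tower 2I+ℓ next to two charged factors» = (F-c)), `dt1P_has_O`. §3 Ψ of a cell
(`Cell.psi := psiLC`), PROVED to factor through the key (`psi_eq_psiKey`, a symmetric rewriting of the closed form, `ring`), and the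
universe's Ψ table re-certified on keys (`dt1_psiKey_table`: P-shapes Ψ = 0; N-shapes Ψ < 0 iff species; no-O N-shapes Ψ > 0).
§4 two-level (F1ℝ) designs as constituent LISTS (multiplicity by repetition, as FILE A): `muTermC = Π_f β_f` (`β = a − b`), the
μ-word `muC` ((H1) ⟺ `muC ≠ 0`), the Ψ-mass `psiSumC`. §5 `dt1_squeeze` PROVED: (H1) + Ψ-row ⇒ an N-constituent is a species
(μ ≠ 0 needs a no-O constituent, necessarily an N with Ψ > 0; P-mass is Ψ-null; so the N-side needs negative Ψ — LEMMA Ψ₁'s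
mechanism, `Pad4TowerPsi`). §6 `A2IDead_of_species_pattern` ∕ `species_A2IDead` PROVED via `Pad4TowerLemmaA2I.A2IDead_of_oneSided`:
pair (σ, f″) = (a ray factor, the O-factor), entry `(s, s̄)`; a present `(σ,s)`-partner is the FULL cancellation (a partial descent
would be a P with a tower and one O — `dt1P_tower_two_O`), served above along `(f″, s)` by the TRANSPOSED cell `Z ∘ (σ f″)` ∈ E₋
(G-invariance: the own-orbit server of the verdicts), whose polluters = side-`s` lifted classes `[k·ℓ|O|…]` are again P's with a
tower and ≤ 1 O — absent; `species_partner_present`: under RULE D the partner exists (LEMMA F apex case,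
`Pad4TowerLemmaT.servedBelow_of_zero`) — the kill is not the vacuous one there. §7 `dt1_universe_closed` = §5 + §6.

WHAT IS NOT HERE ∕ NOT IN LEAN (as in the tower files): the (E1)-unsolvability behind `A2IDead` (LEMMA A∪2I′, pencil ×2) and Ψ's
annihilation of `ℚ[h] ⊕ W` (PAD4-THEOREM-L (6.5), pencil ×2) — so «closed at first order» means here exactly «(H1) + Ψ-row force
an N-constituent satisfying the typed kill predicate»; the μ₄ phases `±i`; RULE-D fixpoints (not needed for this universe); any
(H1)-LP beyond the Ψ-row (not needed: every Ψ ≠ 0 shape of the universe is an N-shape). Nothing is a statement about a variety, a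
sheaf, σ, a seed or an abelian variety; NOTHING HERE SAYS THAT HC ∕ HC_CM ∕ HC_AV ∕ W₆ ∕ HC_Kum4Type HOLDS OR FAILS. No
`instance`, no notation, no named fact, 0 `sorry`; axioms standard.

SOURCES (sha16): census words U(D_T1-universe) c94531e97af3470b (cell INBOX l.30315 ∕ l.30429); verdicts s4-ref-2 g10
3f87db5a1884753a (l.30259), s4-ref g71 30a58cd959697c55 (l.30300), s4-ref-2 g11 squeeze ×2 (l.30403); gs-eng-2 g48 l.30214;
`Pad4TowerPsi.lean` b23c6bbb35c2be0c, `Pad4TowerLemmaT.lean` bfb2cc0a1a90b649, `Pad4TowerLemmaA2I.lean` f584dd8287830a21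
(typer hodge-lit-semireg-typer-2 g0); PAD4-BALANCED-search-1.md v1.6 e2d93ac598b3704c §17 (LEMMA A∪2I′), PAD4-THEOREM-L v1.2 (6.5).
-/

namespace Summit.Ventures.HSemireg.Pad4Tower
open Finset

/-! ## §1 Letters, keys (the phase-blind shape of a cell) -/

/-- the NORMALISED LETTER of `Z` on factor `f`: its two light-cone coordinates sorted, `(max, min)` — `O = (0,0)`, a pure ray
of charge `c` on either side `= (c,0)`, the node `2I = (1,1)`, the tower `2I+ℓ = (2,1)` on either side, … (side-blind). -/
def nl (Z : Cell) (f : Fin 4) : ℕ × ℕ := (max (Z f 0) (Z f 1), min (Z f 0) (Z f 1))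

/-- the KEY of a cell = the multiset of its four normalised letters (its `S₄ × (sides)`-orbit invariant = the phase-blind
SHAPE `[x₀|x₁|x₂|x₃]` of the cell's orbit, as the cell's tables are written). -/
def Cell.key (Z : Cell) : Multiset (ℕ × ℕ) := (univ : Finset (Fin 4)).val.map (nl Z)

/-- the key of a shape written as a vector of letters (as in `Pad4TowerPsi.dt1Orbits`). -/
def shapeKey (sh : Fin 4 → ℕ × ℕ) : Multiset (ℕ × ℕ) := (univ : Finset (Fin 4)).val.map sh

/-- every factor's letter is in the key. -/
theorem nl_mem_key (Z : Cell) (f : Fin 4) : nl Z f ∈ Z.key := Multiset.mem_map_of_mem _ (Finset.mem_univ_val f)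

/-- a letter of the key sits on some factor. -/
theorem exists_of_mem_key {Z : Cell} {x : ℕ × ℕ} (h : x ∈ Z.key) : ∃ f, nl Z f = x :=
  let ⟨f, _, hf⟩ := Multiset.mem_map.1 h; ⟨f, hf⟩

/-- the multiplicity of a letter in the key = the number of factors carrying it. -/
theorem count_key (Z : Cell) (x : ℕ × ℕ) : Z.key.count x = (univ.filter fun f => x = nl Z f).card := by
  unfold Cell.key; rw [Multiset.count_map]; rfl

/-- an O-factor has normalised letter `(0,0)`, and conversely. -/
theorem nl_eq_zero_iff (Z : Cell) (f : Fin 4) : nl Z f = (0, 0) ↔ isO Z f := by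
  unfold nl isO
  refine ⟨fun h => ?_, fun ⟨h0, h1⟩ => by simp [h0, h1]⟩
  have h1 := (Prod.mk.injEq _ _ _ _).mp h
  constructor <;> omega

/-- a pure ray of charge `c` on side `s` has normalised letter `(c, 0)`. -/
theorem nl_of_pureRay {Z : Cell} {f : Fin 4} {s : Fin 2} (h : pureRay Z f s) : nl Z f = (Z f s, 0) := by
  obtain ⟨h1, h2⟩ := h
  fin_cases s <;> simp_all [nl]

/-- if at most the factor `σ` can be an O-factor, the key counts `(0,0)` at most once. -/
theorem count_zero_le_one {Z : Cell} (σ : Fin 4) (h : ∀ g, g ≠ σ → nl Z g ≠ (0, 0)) : Z.key.count (0, 0) ≤ 1 := by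
  rw [count_key]
  refine Finset.card_le_one.2 fun a ha b hb => ?_
  rw [Finset.mem_filter] at ha hb
  rw [show a = σ by by_contra hne; exact h a hne ha.2.symm, show b = σ by by_contra hne; exact h b hne hb.2.symm]

/-- if the key counts `(0,0)` exactly once and `f″` is an O-factor, no other factor is. -/
theorem nl_ne_zero_of_count_eq_one {Z : Cell} (h : Z.key.count (0, 0) = 1) {f'' : Fin 4} (hO : nl Z f'' = (0, 0))
    {g : Fin 4} (hg : g ≠ f'') : nl Z g ≠ (0, 0) := by
  intro hg0
  rw [count_key] at h
  exact hg (Finset.card_le_one.1 h.le g (by simp [hg0]) f'' (by simp [hO]))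
/-! ## §2 The universe U(D_T1), (F1ℝ) slice, by keys -/

/-- the keys of the 30 `N`-orbits of the 46-orbit universe U(D_T1) (`Pad4TowerPsi.dt1Orbits`, level `true`). -/
def dt1NKeys : List (Multiset (ℕ × ℕ)) := (dt1Orbits.filter fun o => o.1).map fun o => shapeKey o.2.1

/-- the keys of the 16 `P`-orbits of U(D_T1) (`dt1Orbits`, level `false`). -/
def dt1PKeys : List (Multiset (ℕ × ℕ)) := (dt1Orbits.filter fun o => !o.1).map fun o => shapeKey o.2.1

/-- the keys of the THREE TOWER SPECIES (the negative-Ψ `N`-orbits of the squeeze, `Pad4TowerPsi.dt1_negative_carriers`):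
o35 `[O|ℓ|ℓ|2I+ℓ]`, o38 `[O|ℓ|2ℓ|2I+ℓ]`, o41 `[O|2ℓ|2ℓ|2I+ℓ]`, written as explicit multisets of normalised letters. -/
def speciesKeys : List (Multiset (ℕ × ℕ)) :=
  [{(0, 0), (1, 0), (1, 0), (2, 1)}, {(0, 0), (1, 0), (2, 0), (2, 1)}, {(0, 0), (2, 0), (2, 0), (2, 1)}]

/-- bookkeeping: 30 + 16 keys; the species keys ARE the keys of orbits 35, 38, 41 of `dt1Orbits`. [kernel, `decide`] -/
theorem dt1Keys_counts :
    dt1NKeys.length = 30 ∧ dt1PKeys.length = 16 ∧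
      speciesKeys = [35, 38, 41].map (fun i => shapeKey (dt1Orbits.getD i (false, ![lO, lO, lO, lO], 0)).2.1) := by
  decide +kernel

/-- **a cell lies in the `N`-alphabet of U(D_T1)^ℝ**: its key (phase-blind shape) is one of the 30 `N`-orbit shapes — i.e. the
cell is a member of one of those orbits with phases `±1` (either light-cone side on each factor, any placement of the letters). -/
abbrev InDT1N (Z : Cell) : Prop := Z.key ∈ dt1NKeys

/-- **a cell lies in the `P`-alphabet of U(D_T1)^ℝ** (one of the 16 `P`-orbit shapes). -/
abbrev InDT1P (Z : Cell) : Prop := Z.key ∈ dt1PKeys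

/-- **the one support fact the kill reads** ((F-c) of s4-ref-2 g10 ∕ s4-ref g71: «no P-orbit of the 46 carries a tower letter with
≥ 2 further charged factors»): every `P`-shape of U(D_T1) containing the tower `2I+ℓ` has at least two O-factors. [kernel, `decide`] -/
theorem dt1P_tower_two_O : ∀ K ∈ dt1PKeys, (2, 1) ∈ K → 2 ≤ K.count (0, 0) := by decide +kernel

/-- every `P`-shape of U(D_T1) has an O-factor (so no `P`-cell is fully charged: its μ-term vanishes). [kernel, `decide`] -/
theorem dt1P_has_O : ∀ K ∈ dt1PKeys, (0, 0) ∈ K := by decide +kernel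
/-! ## §3 Ψ of a cell, through its key -/

/-- **Ψ of an (F1ℝ) cell** = `Pad4TowerPsi.psiLC` of its light-cone coordinates (`α_f = a_f + b_f`, `s_f = (a_f − b_f)²`). -/
def Cell.psi (Z : Cell) : ℚ := psiLC fun f => (Z f 0, Z f 1)

/-- `α` of a normalised letter. -/
def letA (x : ℕ × ℕ) : ℚ := (x.1 : ℚ) + x.2
/-- `s = |β|²` of a normalised letter. -/
def letS (x : ℕ × ℕ) : ℚ := ((x.1 : ℚ) - x.2) ^ 2
/-- the pairing factor `A(x,y) = s_x + s_y − (α_x − α_y)²` of two letters (`Pad4TowerPsi.pairTerm`). -/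
def letPair (x y : ℕ × ℕ) : ℚ := letS x + letS y - (letA x - letA y) ^ 2

/-- **Ψ as a function of the KEY** (a manifestly symmetric rewriting of the closed form: with `Σ₂ = Σ_{f<g} A_{fg}`,
`Σ₂² − Σ_{f<g} A_{fg}²` counts every pair of distinct edges twice; removing the 12 vertex-sharing pairs leaves the 3 pairings). -/
def psiKey (M : Multiset (ℕ × ℕ)) : ℚ :=
  let e1 := (M.map fun x => (M.map fun y => letPair x y).sum).sum - (M.map fun x => letPair x x).sum
  let e2 := (M.map fun x => (M.map fun y => letPair x y ^ 2).sum).sum - (M.map fun x => letPair x x ^ 2).sum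
  let star := (M.map fun x =>
      ((M.map fun y => letPair x y).sum - letPair x x) ^ 2 - ((M.map fun y => letPair x y ^ 2).sum - letPair x x ^ 2)).sum
  (((e1 / 2) ^ 2 - e2 / 2) / 2 - star / 2) / 12

/-- `α` of the normalised letter = `a + b`. -/
theorem letA_nl (Z : Cell) (f : Fin 4) : letA (nl Z f) = (Z f 0 : ℚ) + Z f 1 := by
  unfold letA nl
  rcases le_total (Z f 0) (Z f 1) with h | h
  · rw [max_eq_right h, min_eq_left h]; push_cast; ring
  · rw [max_eq_left h, min_eq_right h]

/-- `s` of the normalised letter = `(a − b)²`. -/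
theorem letS_nl (Z : Cell) (f : Fin 4) : letS (nl Z f) = ((Z f 0 : ℚ) - Z f 1) ^ 2 := by
  unfold letS nl
  rcases le_total (Z f 0) (Z f 1) with h | h
  · rw [max_eq_right h, min_eq_left h]; ring
  · rw [max_eq_left h, min_eq_right h]

/-- **Ψ depends only on the key.** -/
theorem psi_eq_psiKey (Z : Cell) : Z.psi = psiKey Z.key := by
  have hsum : ∀ g : Fin 4 → ℚ, ((univ : Finset (Fin 4)).val.map g).sum = ∑ f, g f := fun g => rfl
  simp only [psiKey, Cell.key, Multiset.map_map, Function.comp_def, hsum, letPair, letA_nl, letS_nl, Fin.sum_univ_four]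
  simp only [Cell.psi, psiLC, psiForm, pairTerm]
  ring

/-- **the Ψ table of U(D_T1) read through keys** (`Pad4TowerPsi.dt1_negative_carriers`, re-certified on `psiKey`): every `P`-shape
has Ψ = 0; an `N`-shape has Ψ < 0 iff it is one of the three species; an `N`-shape without O-factor (the fully charged o42–o45)
has Ψ > 0. [kernel, `decide`] -/
theorem dt1_psiKey_table :
    (∀ K ∈ dt1PKeys, psiKey K = 0) ∧ (∀ K ∈ dt1NKeys, psiKey K < 0 ↔ K ∈ speciesKeys) ∧
      (∀ K ∈ dt1NKeys, (0, 0) ∉ K → 0 < psiKey K) := by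
  decide +kernel
/-! ## §4 Two-level (F1ℝ) designs with multiplicities: the μ-word and the Ψ-row -/

/-- the contribution `Π_f β_f` of an (F1ℝ) cell to the `W`-part `μ` of `ch` (`β_f = a_f − b_f` in the light-cone frame;
PAD4-BALANCED §0 ∕ PAD4-FIRSTORDER §0 (H1); the (F1ℝ) counterpart of FILE A's `Constituent.muTerm`). -/
def muTermC (Z : Cell) : ℤ := ∏ f, ((Z f 0 : ℤ) - Z f 1)

/-- **the μ-word of a two-level (F1ℝ) design** given by its constituent lists (multiplicity by repetition, as in FILE A's
`Design`): `μ = Σ_N Π_f β_f − Σ_P Π_f β_f`. (H1) of PAD4-FIRSTORDER §0 reads `μ ≠ 0` (FILE A `Design.H1`, here on (F1ℝ) cells). -/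
def muC (lower upper : List Cell) : ℤ := (lower.map muTermC).sum - (upper.map muTermC).sum

/-- the Ψ-mass of a constituent list ((F1ℝ) counterpart of `Pad4TowerPsi.psiSum`). -/
def psiSumC (l : List Cell) : ℚ := (l.map Cell.psi).sum

/-- a cell with an O-factor contributes nothing to `μ`. -/
theorem muTermC_eq_zero_of_O {Z : Cell} {f : Fin 4} (h : nl Z f = (0, 0)) : muTermC Z = 0 :=
  Finset.prod_eq_zero (Finset.mem_univ f) (by rw [nl_eq_zero_iff] at h; simp [h.1, h.2])

/-- a cell with `Π_f β_f ≠ 0` has no O-factor: `(0,0)` is not in its key. -/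
theorem zero_notMem_key_of_muTermC {Z : Cell} (h : muTermC Z ≠ 0) : (0, 0) ∉ Z.key := fun hm => by
  obtain ⟨f, hf⟩ := exists_of_mem_key hm
  exact h (muTermC_eq_zero_of_O hf)

/-- `μ ≠ 0` ⇒ some constituent has `Π_f β_f ≠ 0` (FILE A `exists_fullyCharged_of_H1`, (F1ℝ) form). -/
theorem exists_muTermC_ne_zero {lower upper : List Cell} (h : muC lower upper ≠ 0) :
    ∃ X ∈ lower ++ upper, muTermC X ≠ 0 := by
  by_contra hne
  push Not at hne
  have hz : ∀ l : List Cell, (∀ X ∈ l, muTermC X = 0) → (l.map muTermC).sum = 0 := fun l hl =>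
    List.sum_eq_zero fun x hx => by obtain ⟨X, hX, rfl⟩ := List.mem_map.1 hx; exact hl X hX
  apply h; unfold muC
  rw [hz lower fun X hX => hne X (List.mem_append_left _ hX),
    hz upper fun X hX => hne X (List.mem_append_right _ hX), sub_zero]

/-! ## §5 THE SQUEEZE: in U(D_T1)^ℝ, (H1) and the Ψ-row put positive multiplicity on a tower species -/

/-- **U(D_T1) SQUEEZE, (F1ℝ) slice** (census entry c94531e97af3470b, first clause; gs-eng-2 g48 l.30214; LEMMA Ψ₁'s mechanism):
a two-level design with `N`-constituents in the `N`-alphabet and `P`-constituents in the `P`-alphabet of U(D_T1)^ℝ, with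
`μ ≠ 0` ((H1)) and the Ψ-row `Σ_N Ψ = Σ_P Ψ`, has an `N`-constituent of a tower species o35 `[O|ℓ|ℓ|2I+ℓ]`, o38 `[O|ℓ|2ℓ|2I+ℓ]`,
o41 `[O|2ℓ|2ℓ|2I+ℓ]` (μ ≠ 0 needs a no-O constituent — an `N` of Ψ > 0; P-mass is Ψ-null; only the species carry Ψ < 0). -/
theorem dt1_squeeze (lower upper : List Cell) (hN : ∀ Z ∈ lower, InDT1N Z) (hP : ∀ P ∈ upper, InDT1P P)
    (h1 : muC lower upper ≠ 0) (hΨ : psiSumC lower = psiSumC upper) : ∃ Z ∈ lower, Z.key ∈ speciesKeys := by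
  obtain ⟨hP0, hNneg, hNpos⟩ := dt1_psiKey_table
  -- the P-side Ψ-mass vanishes, hence so does the N-side
  have hup : psiSumC upper = 0 := List.sum_eq_zero fun x hx => by
    obtain ⟨P, hPm, rfl⟩ := List.mem_map.1 hx
    rw [psi_eq_psiKey]; exact hP0 _ (hP P hPm)
  have hlow : psiSumC lower = 0 := hΨ.trans hup
  -- (H1) gives a constituent with Π β ≠ 0; it is an N (P's have O-factors) and has Ψ > 0
  obtain ⟨X, hXmem, hX⟩ := exists_muTermC_ne_zero h1
  have hXl : X ∈ lower := (List.mem_append.1 hXmem).resolve_right fun h =>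
    zero_notMem_key_of_muTermC hX (dt1P_has_O _ (hP X h))
  have hXpos : 0 < X.psi := by rw [psi_eq_psiKey]; exact hNpos _ (hN X hXl) (zero_notMem_key_of_muTermC hX)
  -- so some N has Ψ < 0, i.e. is a species
  by_contra hno
  push Not at hno
  have hnn : ∀ x ∈ lower.map Cell.psi, (0 : ℚ) ≤ x := fun x hx => by
    obtain ⟨Z, hZ, rfl⟩ := List.mem_map.1 hx
    by_contra hlt
    exact hno Z hZ ((hNneg _ (hN Z hZ)).1 (by rw [← psi_eq_psiKey]; exact not_le.1 hlt))
  have hle : X.psi ≤ psiSumC lower := List.single_le_sum hnn _ (List.mem_map.2 ⟨X, hXl, rfl⟩)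
  rw [hlow] at hle
  exact absurd hXpos (not_lt.2 hle)

/-! ## §6 THE KILL: in a G-invariant support inside U(D_T1)^ℝ every species cell satisfies the clean-form kill `A2IDead` -/

/-- **relabelling invariance of a support** (the `S₄` part of the cell's symmetry group `G = H ⋊ S₄`; a G-invariant = G-closed
support is in particular `S₄`-invariant — only this part is used, so the phase group `H` need not be modelled): closed under
permuting the four factors. Mode I: a condition on the support (classes), not on multiplicities. -/
abbrev GInvariant (S : Finset Cell) : Prop := ∀ Z ∈ S, ∀ π : Equiv.Perm (Fin 4), (fun f s => Z (π f) s) ∈ S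

/-- **SPECIES KILL, structural form.** Let the `N`-cell `Z` have an O-factor `f″`, a pure ray on `(σ,s)`, a factor `τ` carrying
the tower `2I+ℓ`, and no second O-factor; let every `P`-cell have its shape in a list `PK` whose tower-carrying shapes have
two O-factors (the `P`-alphabet of U(D_T1)^ℝ: `dt1P_tower_two_O`; also M*(U6)'s), and let the TRANSPOSED cell
`Z ∘ (σ f″)` (the own-orbit server `[c·ℓ|O|…]` of the full cancellation partner) be an `N`-cell. Then `A2IDead C Z σ f″`
(`Pad4TowerLemmaA2I`, via `A2IDead_of_oneSided` with `w = s`): a present `(σ,s)`-partner is the full cancellation (a partial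
descent would be a `P` with a tower and one O-factor), it is served above along `(f″,s)` by the
transposed cell, and a side-`s` lifted class would again be a `P` with a tower and at most one O-factor. -/
theorem A2IDead_of_species_pattern (C : Config) {PK : List (Multiset (ℕ × ℕ))}
    (hPK : ∀ K ∈ PK, (2, 1) ∈ K → 2 ≤ K.count (0, 0)) (hP : ∀ P ∈ C.upper, P.key ∈ PK) {Z : Cell} {σ f'' τ : Fin 4}
    {s : Fin 2} (hO : isO Z f'') (hray : pureRay Z σ s) (hτ : nl Z τ = (2, 1)) (honly : ∀ g, g ≠ f'' → nl Z g ≠ (0, 0))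
    (hsrv : (fun f t => Z (Equiv.swap σ f'' f) t) ∈ C.lower) : A2IDead C Z σ f'' := by
  have hne : σ ≠ f'' := fun h => hray.1 (by rw [h]; fin_cases s <;> simp [hO.1, hO.2])
  have hnσ : nl Z σ = (Z σ s, 0) := nl_of_pureRay hray
  have hτσ : τ ≠ σ := fun h => by rw [h, hnσ] at hτ; exact absurd (Prod.mk.injEq _ _ _ _ ▸ hτ).2 (by decide)
  have hτf : τ ≠ f'' := fun h => by rw [h, (nl_eq_zero_iff Z f'').2 hO] at hτ; exact absurd hτ (by decide)
  -- a P-cell agreeing with Z off f″ and (σ,s), not O on f″ unless it is O on σ... : the tower/O-count contradiction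
  have key_contra : ∀ P : Cell, P.key ∈ PK → (∀ g r, g ≠ f'' → ¬ (g = σ ∧ r = s) → P g r = Z g r) →
      (nl P f'' ≠ (0, 0) ∨ nl P σ ≠ (0, 0)) → False := by
    intro P hPk hag hnotboth
    have hPτ : nl P τ = (2, 1) := by
      have h0 : P τ 0 = Z τ 0 := hag τ 0 hτf (fun h => hτσ h.1)
      have h1 : P τ 1 = Z τ 1 := hag τ 1 hτf (fun h => hτσ h.1)
      unfold nl at hτ ⊢; rw [h0, h1]; exact hτ
    have hmem : (2, 1) ∈ P.key := hPτ ▸ nl_mem_key P τ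
    have h2 := hPK _ hPk hmem
    -- at most one O-factor: the factors off {σ, f″} copy Z's non-O letters, and one of σ, f″ is not O
    have hoff : ∀ g, g ≠ f'' → g ≠ σ → nl P g ≠ (0, 0) := by
      intro g hg1 hg2
      have h0 : P g 0 = Z g 0 := hag g 0 hg1 (fun h => hg2 h.1)
      have h1 : P g 1 = Z g 1 := hag g 1 hg1 (fun h => hg2 h.1)
      have : nl P g = nl Z g := by unfold nl; rw [h0, h1]
      rw [this]; exact honly g hg1
    have hle : P.key.count (0, 0) ≤ 1 := by
      rcases hnotboth with h | h
      · exact count_zero_le_one σ fun g hg => if hgf : g = f'' then hgf ▸ h else hoff g hgf hg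
      · exact count_zero_le_one f'' fun g hg => if hgσ : g = σ then hgσ ▸ h else hoff g hg hgσ
    omega
  refine A2IDead_of_oneSided C hne hO hray s ?_ ?_
  · -- every present (σ,s)-partner is the full cancellation and is served above along (f″,s) by the transposed cell
    intro P hPu hag hlt
    have hP0 : P σ s = 0 := by
      by_contra hpos
      refine key_contra P (hP P hPu) (fun g r hg hgs => hag g r hgs) (Or.inr fun hO' => ?_)
      rw [nl_eq_zero_iff] at hO'
      fin_cases s; exacts [hpos hO'.1, hpos hO'.2]
    refine ⟨_, hsrv, ?_, ?_⟩
    · intro g r hgr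
      show Z (Equiv.swap σ f'' g) r = P g r
      by_cases hgf : g = f''
      · subst hgf
        rw [Equiv.swap_apply_right]
        have hr : r = s.rev := Fin2.eq_rev_of_ne r s (fun h => hgr ⟨rfl, h⟩)
        rw [hr, hray.2, hag g s.rev (fun h => hne.symm h.1)]
        fin_cases s; exacts [hO.2.symm, hO.1.symm]
      · by_cases hgσ : g = σ
        · subst hgσ
          rw [Equiv.swap_apply_left]
          by_cases hrs : r = s
          · subst hrs; rw [hP0]; fin_cases r; exacts [hO.1, hO.2]
          · rw [hag g r (fun h => hrs h.2)]
            have hr : r = s.rev := Fin2.eq_rev_of_ne r s hrs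
            rw [hr, hray.2]; fin_cases s; exacts [hO.2, hO.1]
        · rw [Equiv.swap_apply_of_ne_of_ne hgσ hgf, hag g r (fun h => hgσ h.1)]
    · show P f'' s < Z (Equiv.swap σ f'' f'') s
      rw [Equiv.swap_apply_right, hag f'' s (fun h => hne.symm h.1)]
      have : Z f'' s = 0 := by fin_cases s; exacts [hO.1, hO.2]
      rw [this]; exact Nat.pos_of_ne_zero hray.1
  · -- no side-s lifted class over f″ is a P-cell
    rintro P hPu ⟨hag, -, hrayP⟩
    exact key_contra P (hP P hPu) hag (Or.inl (by rw [nl_of_pureRay hrayP]; simp [hrayP.1]))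

/-- a factor whose normalised letter is a ray `(c,0)`, `c > 0`, is a pure ray on one of the two sides. -/
theorem exists_pureRay_of_nl {Z : Cell} {f : Fin 4} {c : ℕ} (h : nl Z f = (c, 0)) (hc : 0 < c) : ∃ s, pureRay Z f s := by
  unfold nl at h
  have h1 := (Prod.mk.injEq _ _ _ _).mp h
  rcases le_total (Z f 0) (Z f 1) with hle | hle
  · rw [max_eq_right hle, min_eq_left hle] at h1
    exact ⟨1, by simp [pureRay]; omega⟩
  · rw [max_eq_left hle, min_eq_right hle] at h1
    exact ⟨0, by simp [pureRay]; omega⟩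

/-- what the three species keys have in common: one O, a ray `ℓ` or `2ℓ`, the tower `2I+ℓ`. [kernel, `decide`] -/
theorem speciesKeys_pattern :
    ∀ K ∈ speciesKeys, (0, 0) ∈ K ∧ ((1, 0) ∈ K ∨ (2, 0) ∈ K) ∧ (2, 1) ∈ K ∧ K.count (0, 0) = 1 := by decide +kernel

/-- a species cell has the pattern of `A2IDead_of_species_pattern`: an O-factor `f″`, a pure ray `(σ,s)`, a tower factor `τ`,
and no second O-factor. -/
theorem species_pattern {Z : Cell} (hk : Z.key ∈ speciesKeys) :
    ∃ f'' σ τ : Fin 4, ∃ s : Fin 2, isO Z f'' ∧ pureRay Z σ s ∧ nl Z τ = (2, 1) ∧ ∀ g, g ≠ f'' → nl Z g ≠ (0, 0) := by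
  obtain ⟨h0, hray, h21, hcount⟩ := speciesKeys_pattern _ hk
  obtain ⟨f'', hf''⟩ := exists_of_mem_key h0
  obtain ⟨τ, hτ⟩ := exists_of_mem_key h21
  have hσ : ∃ σ : Fin 4, ∃ s : Fin 2, pureRay Z σ s := by
    rcases hray with h | h <;>
    · obtain ⟨σ, hσ⟩ := exists_of_mem_key h
      exact ⟨σ, exists_pureRay_of_nl hσ (by decide)⟩
  obtain ⟨σ, s, hs⟩ := hσ
  exact ⟨f'', σ, τ, s, (nl_eq_zero_iff Z f'').1 hf'', hs, hτ, fun g hg => nl_ne_zero_of_count_eq_one hcount hf'' hg⟩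

/-- **THE THREE TOWER SPECIES ARE DEAD in every G-invariant support inside U(D_T1)^ℝ** (census entry c94531e97af3470b, second
clause, (F1ℝ) slice; pencil ×2 s4-ref-2 g10 3f87db5a1884753a + s4-ref g71 30a58cd959697c55, scope «G-invariant, mode I»): if the
`P`-cells have shapes in a list `PK` as above (e.g. the `P`-alphabet of U(D_T1)^ℝ) and the `N`-support is G-invariant, every
`N`-cell of species o35∕o38∕o41 satisfies the
LEMMA-A∪2I′ clean-form kill `A2IDead` (`Pad4TowerLemmaA2I`) for a pair (ray factor, O-factor). RULE D is not needed by the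
predicate (an absent partner leaves the demanded entry unfed outright); under RULE D the partner is present (`species_partner_present`).
Pencil meaning of `A2IDead` (NOT in Lean): such a cell violates (E1). -/
theorem species_A2IDead (C : Config) {PK : List (Multiset (ℕ × ℕ))} (hPK : ∀ K ∈ PK, (2, 1) ∈ K → 2 ≤ K.count (0, 0))
    (hP : ∀ P ∈ C.upper, P.key ∈ PK) (hG : GInvariant C.lower) {Z : Cell} (hZ : Z ∈ C.lower)
    (hk : Z.key ∈ speciesKeys) : ∃ σ f'' : Fin 4, A2IDead C Z σ f'' := by
  obtain ⟨f'', σ, τ, s, hO, hray, hτ, honly⟩ := species_pattern hk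
  refine ⟨σ, f'', A2IDead_of_species_pattern C hPK hP hO hray hτ honly ?_⟩
  exact hG Z hZ (Equiv.swap σ f'')

/-- (the non-vacuous case) in a RULE-D-closed configuration a species cell HAS its `(σ,s)`-partner: RULE D at the pair (ray, O-factor)
can only be met by the own leg (`Pad4TowerLemmaT.servedBelow_of_zero`; LEMMA F, apex case). -/
theorem species_partner_present (C : Config) {Z : Cell} (hZ : RuleDN C Z) {σ f'' : Fin 4} {s : Fin 2} (hO : isO Z f'')
    (hray : pureRay Z σ s) (hne : σ ≠ f'') : ServedBelow C Z σ s :=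
  servedBelow_of_zero C hZ (f₀ := f'') (r₀ := s) (by fin_cases s; exacts [hO.1, hO.2]) hne hray.1

/-! ## §7 ASSEMBLY: U(D_T1)^ℝ is closed at first order -/

/-- **THE UNIVERSE U(D_T1) IS CLOSED AT FIRST ORDER — (F1ℝ) SLICE, KERNEL FORM** of census entry 3 (director-hodge g7,
U(D_T1-universe) c94531e97af3470b, FINAL 2026-08-27T10:11Z): for every two-level (F1ℝ) design (constituent lists, multiplicity by
repetition) with `N`-constituents in the 30 `N`-shapes and `P`-constituents in the 16 `P`-shapes of the 46-orbit universe
U(D_T1) = T376^G (phases `±1`) and G-invariant `N`-support: (H1) (`μ ≠ 0`) with the Ψ-row of the class condition forces an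
`N`-constituent of a tower species o35∕o38∕o41, and that constituent satisfies the clean-form kill `A2IDead` of LEMMA A∪2I′ in
the design's support. NOT IN LEAN (as in the tower files): the (E1)-unsolvability behind `A2IDead` and Ψ's annihilation of
`ℚ[h] ⊕ W` (both pencil ×2); the μ₄ universe proper (phases `±i`) needs the μ₄ form of the kill predicate, absent from the tree.
Nothing here is a statement about a variety, a sheaf, σ, a seed or an abelian variety; nothing here says HC ∕ HC_CM ∕ HC_AV holds or fails. -/
theorem dt1_universe_closed (lower upper : List Cell) (hN : ∀ Z ∈ lower, InDT1N Z) (hP : ∀ P ∈ upper, InDT1P P)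
    (h1 : muC lower upper ≠ 0) (hΨ : psiSumC lower = psiSumC upper) (hG : GInvariant lower.toFinset) :
    ∃ Z ∈ lower, Z.key ∈ speciesKeys ∧ ∃ σ f'' : Fin 4, A2IDead ⟨lower.toFinset, upper.toFinset⟩ Z σ f'' := by
  obtain ⟨Z, hZ, hk⟩ := dt1_squeeze lower upper hN hP h1 hΨ
  refine ⟨Z, hZ, hk, species_A2IDead ⟨lower.toFinset, upper.toFinset⟩ dt1P_tower_two_O ?_ hG (List.mem_toFinset.2 hZ) hk⟩
  intro P hPu
  exact hP P (List.mem_toFinset.1 hPu)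

end Summit.Ventures.HSemireg.Pad4Tower
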